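import Summits.RiemannHypothesis.RiemannHypothesis.Theorems.Splittings.RobinFiniteE1cUpperFormula
import HarnessLib

/-!
# E1c⁺ part 2 — truncated RH-free Cor. 2.1 from the kernel `θ`-table (U3), the partial-RH UPPER core bound `corePwUpper` (U4), numerics (U5)

Pub cell `rh-split` (robin, finite) gen 10, CARVE-g10 part 2/3 of the checked object `SketchG10-Upper.lean` (bodies verbatim,
one shared namespace `Summit.RiemannHypothesis.RiemannHypothesis.Theorems.Splittings.RobinFiniteE1c`).  Zero `def`, zero `sorry`,
no `native_decide` in this file; everything RH-shaped is a HYPOTHESIS `RiemannHypothesisUpTo T` except the one instance discharged by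
the tree theorem `riemannHypothesisUpTo_100000` (part 3).
SPLITTING SEARCH over kernel-typed RH-EQUIVALENCES; a splitting A ∧ B ⟹ RH is CONDITIONAL bookkeeping unless A and B are
both proved; nothing here bears on the truth of RH.
-/

set_option linter.dupNamespace false

noncomputable section

open Complex Filter Set MeasureTheory Topology intervalIntegral
open scoped Real Chebyshev ComplexConjugate

namespace Summit.RiemannHypothesis.RiemannHypothesis.Theorems.Splittings.RobinFiniteE1c

open Literature.NumberTheory.LFunctions Literature.NumberTheory.DiophantineGeometry
open Nicolas NicolasJ NicolasFz NicolasK NicolasJExplicit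

/-! ### U3 · Cor. 2.1 lower half, TRUNCATED and RH-free: `L − K ≥ (4/5)(F_{1/2}(x) − F_{1/2}(Y²))` on `599² ≤ x ≤ Y²`, `Y = 8886113` -/

/-- RH-free: `θ(√t) ≤ ψ(t) − θ(t)` for `t ≥ 4` (`ψ(t) − θ(t) = Σ_{k ≥ 2} θ(t^{1/k})`, Mathlib; every term is `≥ 0`). -/
theorem theta_sqrt_le_psi_sub_theta {t : ℝ} (ht : 4 ≤ t) : θ (Real.sqrt t) ≤ ψ t - θ t := by
  have ht2 : (2 : ℝ) ≤ t := by linarith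
  rw [Chebyshev.psi_eq_theta_add_sum_theta ht2, add_sub_cancel_left]
  have hK : 2 ∈ Finset.Icc 2 ⌊Real.log t / Real.log 2⌋₊ := by
    rw [Finset.mem_Icc]
    refine ⟨le_rfl, Nat.le_floor ?_⟩
    rw [Nat.cast_ofNat, le_div_iff₀ (Real.log_pos one_lt_two)]
    calc (2 : ℝ) * Real.log 2 = Real.log (2 ^ 2) := by rw [Real.log_pow]; norm_num
      _ ≤ Real.log t := Real.log_le_log (by norm_num) (by norm_num; linarith)
  have hle : θ (t ^ ((1 : ℝ) / 2)) ≤ ∑ n ∈ Finset.Icc 2 ⌊Real.log t / Real.log 2⌋₊, θ (t ^ ((1 : ℝ) / n)) := by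
    refine Finset.single_le_sum (f := fun n : ℕ ↦ θ (t ^ ((1 : ℝ) / n))) (fun n _ ↦ Chebyshev.theta_nonneg _) hK
      |>.trans_eq' ?_
    norm_num
  rw [Real.sqrt_eq_rpow]
  exact hle

/-- KERNEL `θ`-input (RH-free, no named fact): `θ(y) ≥ (4/5)y` for `599 ≤ y ≤ 8886113`, from the tree's certified table
`abs_theta_sub_le_smallRange` (`|θ(y) − y| ≤ √y log²y/(8π)` on `[599, 8886113]`) via `theta_ge_four_fifths_of_window`. -/
theorem theta_ge_four_fifths_smallRange {y : ℝ} (hy : 599 ≤ y) (hy' : y ≤ 8886113) : 4 / 5 * y ≤ θ y :=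
  theta_ge_four_fifths_of_window (fun _ hz hzy ↦ abs_theta_sub_le_smallRange hz (hzy.trans hy')) hy

/-- RH-free and named-fact-free: `ψ(t) − θ(t) ≥ (4/5)√t` for `599² ≤ t ≤ 8886113²`. -/
theorem psi_sub_theta_ge_smallRange {t : ℝ} (ht : 358801 ≤ t) (ht' : t ≤ 8886113 ^ 2) :
    4 / 5 * Real.sqrt t ≤ ψ t - θ t := by
  have hsq : (599 : ℝ) ≤ Real.sqrt t := by
    rw [show (599 : ℝ) = Real.sqrt (599 ^ 2) by rw [Real.sqrt_sq (by norm_num)]]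
    exact Real.sqrt_le_sqrt (by norm_num; linarith)
  have hsq' : Real.sqrt t ≤ 8886113 := by
    rw [show (8886113 : ℝ) = Real.sqrt (8886113 ^ 2) by rw [Real.sqrt_sq (by norm_num)]]
    exact Real.sqrt_le_sqrt ht'
  exact (theta_ge_four_fifths_smallRange hsq hsq').trans (theta_sqrt_le_psi_sub_theta (by linarith))

/-- `F_{1/2}(x) − F_{1/2}(B) = ∫_x^B t^{1/2} w₀(t) dt` for `1 < x ≤ B` (uniqueness of limits; `NicolasUpper.tendsto_integral_rpow_mul_w0`). -/
theorem Fhalf_sub_eq_integral {x B : ℝ} (hx : 1 < x) (hxB : x ≤ B) :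
    (Fz (1 / 2 : ℝ) x).re - (Fz (1 / 2 : ℝ) B).re = ∫ t in x..B, t ^ ((1 : ℝ) / 2) * w0 t := by
  have hB : 1 < B := hx.trans_le hxB
  have h1 := NicolasUpper.tendsto_integral_rpow_mul_w0 hx
  have h2 := NicolasUpper.tendsto_integral_rpow_mul_w0 hB
  have h12 := h1.sub h2
  have hconst : Tendsto (fun X : ℝ ↦ (∫ t in x..X, t ^ ((1 : ℝ) / 2) * w0 t) - ∫ t in B..X, t ^ ((1 : ℝ) / 2) * w0 t)
      atTop (𝓝 (∫ t in x..B, t ^ ((1 : ℝ) / 2) * w0 t)) := by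
    refine (tendsto_const_nhds (x := ∫ t in x..B, t ^ ((1 : ℝ) / 2) * w0 t)).congr' ?_
    filter_upwards [eventually_ge_atTop B] with X hX
    have hi1 := intervalIntegrable_rpow_mul_w0 (1 / 2) hx hxB
    have hi2 := intervalIntegrable_rpow_mul_w0 (1 / 2) hB hX
    rw [← intervalIntegral.integral_add_adjacent_intervals hi1 hi2]
    ring
  exact tendsto_nhds_unique h12 hconst

/-- **Cor. 2.1 lower half, truncated, RH-free, named-fact-free**: if `∫_x^X (ψ(t) − t)w₀ → L` then for `599² ≤ x ≤ 8886113²`,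
`L − K(x) ≥ (4/5)(F_{1/2}(x) − F_{1/2}(8886113²))` (`lim_X ∫_x^X (ψ − θ)w₀ ≥ ∫_x^{Y²} (ψ − θ) w₀ ≥ (4/5)∫_x^{Y²} √t w₀`, the
integrand `(ψ − θ)w₀` being `≥ 0` everywhere and `≥ (4/5)√t w₀` on `[599², Y²]`). -/
theorem jk_lower_trunc {x L : ℝ} (hx : 358801 ≤ x) (hxB : x ≤ 8886113 ^ 2)
    (hL : Tendsto (fun X : ℝ ↦ ∫ t in x..X, (ψ t - t) * w0 t) atTop (𝓝 L)) :
    4 / 5 * ((Fz (1 / 2 : ℝ) x).re - (Fz (1 / 2 : ℝ) (8886113 ^ 2)).re) ≤ L - nicolasKInt x := by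
  have hx1 : 1 < x := by linarith
  set B : ℝ := 8886113 ^ 2 with hBdef
  have hB1 : 1 < B := hx1.trans_le hxB
  have hK := NicolasK.tendsto_integral_S_mul_w0 hx1
  have hlim := hL.sub hK
  rw [Fhalf_sub_eq_integral hx1 hxB]
  refine ge_of_tendsto hlim ?_
  filter_upwards [eventually_ge_atTop B] with X hX
  have hxX : x ≤ X := hxB.trans hX
  have hiψ := intervalIntegrable_R_mul_w0 hx1 hxX
  have hiθ := intervalIntegrable_S_mul_w0 hx1 hxX
  rw [← intervalIntegral.integral_sub hiψ hiθ]
  have e2 : (fun t ↦ (ψ t - t) * w0 t - (θ t - t) * w0 t) = fun t ↦ (ψ t - θ t) * w0 t := by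
    funext t; ring
  rw [e2]
  -- interval integrability of `(ψ − θ) w₀` on the two pieces
  have hint : ∀ a b : ℝ, 1 < a → a ≤ b → IntervalIntegrable (fun t ↦ (ψ t - θ t) * w0 t) volume a b := by
    intro a b ha hab
    have h1 := intervalIntegrable_R_mul_w0 ha hab
    have h2 := intervalIntegrable_S_mul_w0 ha hab
    have h3 := h1.sub h2
    refine h3.congr ?_
    · intro t _; ring
  have hsplit : ∫ t in x..X, (ψ t - θ t) * w0 t =
      (∫ t in x..B, (ψ t - θ t) * w0 t) + ∫ t in B..X, (ψ t - θ t) * w0 t :=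
    (intervalIntegral.integral_add_adjacent_intervals (hint x B hx1 hxB) (hint B X hB1 hX)).symm
  have htail : 0 ≤ ∫ t in B..X, (ψ t - θ t) * w0 t := by
    refine intervalIntegral.integral_nonneg hX fun t ht ↦ ?_
    have ht1 : 1 < t := hB1.trans_le ht.1
    exact mul_nonneg (by linarith [Chebyshev.theta_le_psi t]) (w0_pos ht1).le
  have hmain : 4 / 5 * ∫ t in x..B, t ^ ((1 : ℝ) / 2) * w0 t ≤ ∫ t in x..B, (ψ t - θ t) * w0 t := by
    rw [← intervalIntegral.integral_const_mul]
    refine intervalIntegral.integral_mono_on hxB ((intervalIntegrable_rpow_mul_w0 (1 / 2) hx1 hxB).const_mul _)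
      (hint x B hx1 hxB) fun t ht ↦ ?_
    have ht1 : 1 < t := hx1.trans_le ht.1
    have h := psi_sub_theta_ge_smallRange (hx.trans ht.1) ht.2
    rw [Real.sqrt_eq_rpow] at h
    have : 4 / 5 * (t ^ ((1 : ℝ) / 2) * w0 t) = (4 / 5 * t ^ ((1 : ℝ) / 2)) * w0 t := by ring
    rw [this]
    exact mul_le_mul_of_nonneg_right h (w0_pos ht1).le
  rw [hsplit]
  exact hmain.trans (le_add_of_nonneg_right htail)

/-! ### U4 · E1c⁺: the partial-RH UPPER core bound for `log f(x)` on `599² ≤ x ≤ 8886113²` -/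

/-- **E1c⁺ (the partial-RH upper Nicolas inequality, core form; Nicolas 2012 (2.19) under RH up to `T`)**: for
`599² ≤ x ≤ 8886113²`, RH up to height `T` and the weighted off-line bound `Σ_{|γ|>T} m(ρ)x^{Re ρ−1/2}/γ² ≤ D`:
`log f(x) ≤ −(4/5)(2/(√x log x) − 2/(√x log²x)) + (4/5)F_{1/2}(8886113²) + 0.0463(1/(√x log x) + D_x) + (1 + 2/log x)D/(√x log x) + 4/x`.
Inputs: `NicolasUpper.lemma21_upper` (RH-free), U1 `explicitFormula_upper` (RH-free), U2 `zeroSplitBound_upper` (RH(T) + `D`),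
U3 `jk_lower_trunc` (kernel `θ`-table), `NicolasFz.Fhalf_ge`.  NO named fact; `RiemannHypothesisUpTo T` in hypothesis position. -/
theorem corePwUpper {T x D : ℝ} (hx : 358801 ≤ x) (hxB : x ≤ 8886113 ^ 2) (hT : RiemannHypothesisUpTo T)
    (hoff : ∑' ρ : RHWave0.riemannZetaNontrivialZeros,
      (if T < |(ρ : ℂ).im| then
        (riemannZetaZeroOrder (ρ : ℂ) : ℝ) * x ^ ((ρ : ℂ).re - 1 / 2) / (ρ : ℂ).im ^ 2 else 0) ≤ D) :
    Real.log (nicolasF x) ≤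
      -(4 / 5) * (2 / (Real.sqrt x * Real.log x) - 2 / (Real.sqrt x * Real.log x ^ 2))
        + 4 / 5 * (Fz (1 / 2 : ℝ) (8886113 ^ 2)).re
        + (0.0463 * (1 / (Real.sqrt x * Real.log x) + Dx x)
            + (1 + 2 / Real.log x) * D * (1 / (Real.sqrt x * Real.log x)))
        + 4 / x := by
  have hx1 : 1 < x := by linarith
  have h21 := NicolasUpper.lemma21_upper (show (3 : ℝ) ≤ x by linarith)
  obtain ⟨L, hL, hLZ⟩ := explicitFormula_upper (show (2 : ℝ) ≤ x by linarith)
  have hZ := zeroSplitBound_upper hx1 hT hoff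
  have hJK := jk_lower_trunc hx hxB hL
  have hF := NicolasFz.Fhalf_ge hx1
  nlinarith [hJK, hF, hZ, hLZ, h21]

/-! ### U5 · numerics: the truncation constant, the window budget, elementary `log` brackets -/

/-- `log(8886113²) ≥ 31` (`e < 2.7182818286`, `2.7182818286³¹ < 8886113²`). [folklore] -/
theorem log_Ysq_ge : (31 : ℝ) ≤ Real.log (8886113 ^ 2) := by
  rw [Real.le_log_iff_exp_le (by positivity)]
  have h1 : Real.exp 31 = Real.exp 1 ^ 31 := by rw [← Real.exp_nat_mul]; norm_num
  rw [h1]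
  have h2 := Real.exp_one_lt_d9
  have h3 : Real.exp 1 ^ 31 < 2.7182818286 ^ 31 := pow_lt_pow_left₀ h2 (Real.exp_pos 1).le (by norm_num)
  have h4 : (2.7182818286 : ℝ) ^ 31 < 8886113 ^ 2 := by norm_num
  linarith

/-- The truncation constant: `F_{1/2}(8886113²) ≤ 7.3·10⁻⁹` (`F_{1/2}(B) ≤ 2/(√B log B)` for `log B ≥ 4`, `NicolasFz.Fhalf_le`). -/
theorem Fhalf_Ysq_le : (Fz (1 / 2 : ℝ) (8886113 ^ 2)).re ≤ 7.3e-9 := by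
  have hB1 : (1 : ℝ) < 8886113 ^ 2 := by norm_num
  have h := NicolasFz.Fhalf_le hB1
  have hs : Real.sqrt ((8886113 : ℝ) ^ 2) = 8886113 := Real.sqrt_sq (by norm_num)
  rw [hs] at h
  set L := Real.log ((8886113 : ℝ) ^ 2) with hL
  have hL31 : 31 ≤ L := log_Ysq_ge
  have hL0 : 0 < L := by linarith
  have h1 : 8 / (8886113 * L ^ 3) ≤ 2 / (8886113 * L ^ 2) := by
    rw [div_le_div_iff₀ (by positivity) (by positivity)]
    nlinarith [mul_nonneg (sq_nonneg L) (show (0 : ℝ) ≤ L - 4 by linarith)]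
  have h2 : 2 / (8886113 * L) ≤ 2 / (8886113 * 31) :=
    div_le_div_of_nonneg_left (by norm_num) (by positivity) (mul_le_mul_of_nonneg_left hL31 (by norm_num))
  have h3 : (2 : ℝ) / (8886113 * 31) ≤ 7.3e-9 := by norm_num
  linarith

/-- **The window budget** (pure algebra, RH-free): with `A = 1/(sℓ) > 0` every term of the E1c⁺ bound at `x = s²`,
`log x = ℓ ∈ [ℓ₀, ℓ₁]`, `s ∈ [s₀, s₁]`, off-line bound `D ≤ h·s`, truncation `F ≤ ε`, is `≤ (its window constant)·A`, and the
window constants sum to `< 1.6 = (4/5)·2`; hence the bound is `< 0`. -/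
theorem upper_budget_neg {x s ℓ h ε D s₀ s₁ ℓ₀ ℓ₁ F : ℝ} (hs₀ : 0 < s₀) (hℓ₀ : 1 ≤ ℓ₀) (hh : 0 ≤ h) (hε : 0 ≤ ε)
    (hs : s₀ ≤ s) (hs' : s ≤ s₁) (hℓ : ℓ₀ ≤ ℓ) (hℓ' : ℓ ≤ ℓ₁) (hxs : x = s * s) (hD : D ≤ h * s) (hF : F ≤ ε)
    (hnum : 1.6 / ℓ₀ + 0.8 * ε * s₁ * ℓ₁ + 0.0463 * (1 + (1 + 4 / ℓ₀) / ℓ₀) + (1 + 2 / ℓ₀) * h * s₁ + 4 * ℓ₁ / s₀ < 1.6) :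
    -(4 / 5) * (2 / (s * ℓ) - 2 / (s * ℓ ^ 2)) + 4 / 5 * F
      + (0.0463 * (1 / (s * ℓ) + (1 + 4 / ℓ) / (s * ℓ ^ 2)) + (1 + 2 / ℓ) * D * (1 / (s * ℓ)))
      + 4 / x < 0 := by
  have hs0 : 0 < s := hs₀.trans_le hs
  have hℓ0 : 0 < ℓ := by linarith
  have hℓ₀0 : 0 < ℓ₀ := by linarith
  have hs₁0 : 0 < s₁ := hs0.trans_le hs'
  have hℓ₁0 : 0 < ℓ₁ := hℓ0.trans_le hℓ'
  set A : ℝ := 1 / (s * ℓ) with hA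
  have hA0 : 0 < A := by rw [hA]; positivity
  -- every term in units of `A`
  have e1 : 2 / (s * ℓ) = 2 * A := by rw [hA]; ring
  have e2 : 2 / (s * ℓ ^ 2) = 2 * A / ℓ := by rw [hA]; field_simp
  have e3 : (1 + 4 / ℓ) / (s * ℓ ^ 2) = A * ((1 + 4 / ℓ) / ℓ) := by rw [hA]; field_simp
  have e4 : 4 / x = A * (4 * ℓ / s) := by rw [hxs, hA]; field_simp
  -- monotone replacements by the window constants
  have b1 : 2 * A / ℓ ≤ 2 * A / ℓ₀ := div_le_div_of_nonneg_left (by positivity) hℓ₀0 hℓ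
  have b2 : (1 + 4 / ℓ) / ℓ ≤ (1 + 4 / ℓ₀) / ℓ₀ := by
    have ha : 1 + 4 / ℓ ≤ 1 + 4 / ℓ₀ := by
      have := div_le_div_of_nonneg_left (show (0 : ℝ) ≤ 4 by norm_num) hℓ₀0 hℓ
      linarith
    calc (1 + 4 / ℓ) / ℓ ≤ (1 + 4 / ℓ₀) / ℓ := div_le_div_of_nonneg_right ha hℓ0.le
      _ ≤ (1 + 4 / ℓ₀) / ℓ₀ := div_le_div_of_nonneg_left (by positivity) hℓ₀0 hℓ
  have b2' : A * ((1 + 4 / ℓ) / ℓ) ≤ A * ((1 + 4 / ℓ₀) / ℓ₀) := mul_le_mul_of_nonneg_left b2 hA0.le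
  have b3 : (1 + 2 / ℓ) * D ≤ (1 + 2 / ℓ₀) * (h * s₁) := by
    have ha : 1 + 2 / ℓ ≤ 1 + 2 / ℓ₀ := by
      have := div_le_div_of_nonneg_left (show (0 : ℝ) ≤ 2 by norm_num) hℓ₀0 hℓ
      linarith
    have hDs : D ≤ h * s₁ := hD.trans (mul_le_mul_of_nonneg_left hs' hh)
    calc (1 + 2 / ℓ) * D ≤ (1 + 2 / ℓ) * (h * s₁) := mul_le_mul_of_nonneg_left hDs (by positivity)
      _ ≤ (1 + 2 / ℓ₀) * (h * s₁) := mul_le_mul_of_nonneg_right ha (by positivity)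
  have b3' : (1 + 2 / ℓ) * D * A ≤ (1 + 2 / ℓ₀) * (h * s₁) * A := mul_le_mul_of_nonneg_right b3 hA0.le
  have b4 : 4 * ℓ / s ≤ 4 * ℓ₁ / s₀ := by
    rw [div_le_div_iff₀ hs0 hs₀]
    nlinarith [mul_le_mul_of_nonneg_right hℓ' hs₀.le, mul_le_mul_of_nonneg_left hs hℓ₁0.le]
  have b4' : A * (4 * ℓ / s) ≤ A * (4 * ℓ₁ / s₀) := mul_le_mul_of_nonneg_left b4 hA0.le
  have b5 : 4 / 5 * F ≤ A * (0.8 * ε * s₁ * ℓ₁) := by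
    have hq : 1 ≤ s₁ * ℓ₁ / (s * ℓ) := by
      rw [le_div_iff₀ (by positivity)]
      nlinarith [mul_le_mul hs' hℓ' hℓ0.le hs₁0.le]
    have e : A * (0.8 * ε * s₁ * ℓ₁) = 0.8 * ε * (s₁ * ℓ₁ / (s * ℓ)) := by rw [hA]; ring
    rw [e]
    nlinarith [mul_le_mul_of_nonneg_left hq (show (0 : ℝ) ≤ 0.8 * ε by positivity)]
  have hnumA := mul_lt_mul_of_pos_left hnum hA0
  rw [e1, e2, e3, e4]
  have eA : A * (1.6 / ℓ₀ + 0.8 * ε * s₁ * ℓ₁ + 0.0463 * (1 + (1 + 4 / ℓ₀) / ℓ₀) + (1 + 2 / ℓ₀) * h * s₁ + 4 * ℓ₁ / s₀)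
      = 4 / 5 * (2 * A / ℓ₀) + A * (0.8 * ε * s₁ * ℓ₁) + 0.0463 * (A + A * ((1 + 4 / ℓ₀) / ℓ₀))
        + (1 + 2 / ℓ₀) * (h * s₁) * A + A * (4 * ℓ₁ / s₀) := by ring
  rw [eA] at hnumA
  linarith [b1, b2', b3', b4', b5, hnumA, hA0]

/-- `n ≤ log x` from `2.7182818286ⁿ ≤ X ≤ x`. [folklore] -/
theorem natCast_le_log {x X : ℝ} {n : ℕ} (hX : (2.7182818286 : ℝ) ^ n ≤ X) (hX0 : 0 < X) (hx : X ≤ x) :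
    (n : ℝ) ≤ Real.log x := by
  rw [Real.le_log_iff_exp_le (hX0.trans_le hx)]
  have h1 : Real.exp n = Real.exp 1 ^ n := by rw [← Real.exp_nat_mul, mul_one]
  rw [h1]
  have h3 : Real.exp 1 ^ n ≤ 2.7182818286 ^ n := pow_le_pow_left₀ (Real.exp_pos 1).le Real.exp_one_lt_d9.le n
  linarith

/-- `log x ≤ n` from `x ≤ X ≤ 2.7182818283ⁿ`. [folklore] -/
theorem log_le_natCast {x X : ℝ} {n : ℕ} (hX : X ≤ (2.7182818283 : ℝ) ^ n) (hx0 : 0 < x) (hx : x ≤ X) :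
    Real.log x ≤ n := by
  rw [Real.log_le_iff_le_exp hx0]
  have h1 : Real.exp n = Real.exp 1 ^ n := by rw [← Real.exp_nat_mul, mul_one]
  rw [h1]
  have h3 : (2.7182818283 : ℝ) ^ n ≤ Real.exp 1 ^ n := pow_le_pow_left₀ (by norm_num) Real.exp_one_gt_d9.le n
  linarith

end Summit.RiemannHypothesis.RiemannHypothesis.Theorems.Splittings.RobinFiniteE1c

end
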